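import Summits.ABC.IUTFork.Repair.RHOffSigmaToleranceMult
import HarnessLib

/-!
# R-H ROUND 2, Q1 (cell/packet-strata rows 3/4/5; seat abc-iut-rh2-xi-1): the MULTIPLICATIVE abc-tolerance of the off-Σ remainder, II —
# «Cor. 3.12 up to `B`» with `B ≤ T.gap/(2l) + Tol(P, l)` at every admissible datum ∧ the cone binder ⟹ `Thm110Legendre` ⟹ `ThetaPartII` ⟹ `ABC`,
# NO constant of the chain of record changed

PROOF-ONLY sequel (no `def`, no new `Prop`, no instance, no notation; nothing re-typed) of `RHOffSigmaToleranceMult.lean` (this seat: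
`display_of_squeezeIII_mult'`) and `RHOffSigmaTolerance.lean` (p469145: `OffSigmaTolerance`, `gap_le_of_cor312UpTo`), along the spine of
abc-iut-rh2-q2-cond's `Cor312Slack.ABC_of_cor312Slack_of_hullRegime` (p469667) — the `κ = 0` case of the certificate below (same `Tol`). Rung
LADDER-ABC:A2.RESCUE.H, R-H round 2, Q1 rows 3/4/5 (xi-1 §D «T-mult»). TAKES NO SIDE on [IUTchIII] Cor. 3.12 or on any author; typed ≠ proved;
instantiated ≠ endorsed.
* §1 `gap_mul_le_of_tolerance` — «Cor. 3.12 up to `B`» at the datum, `OffSigmaTolerance κ A T B` and the hull estimate with `δ` give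
  `(1 − κ)·T.gap ≤ δ + A + ((l+5)/4)·log π` (no `κ < 1` needed; `gap_le_of_tolerance` of p469145 before the division); `logQAvoid_mul_le_of_tolerance`
  on the `λ`-line (= the hypothesis `hineq` of `display_of_squeezeIII_mult` with `δ = B_III`, `A = E`); `gap_nonneg`, `offSigmaTolerance_of_le_kappa`
  (monotone in `κ`); `gap_div_two_l_eq` (the share `T.gap/(2l) = ((l+1)/(48l) − 1/(4l²))·log(q)` grows with the height — not an `O(d_mod·l²)` budget);
* §2 `thm110Legendre_of_offSigmaToleranceMult_of_hullRegime`, `ThetaPartII_of_offSigmaToleranceMult_of_hullRegime`,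
  **`ABC_of_offSigmaToleranceMult_of_hullRegime`** — [NUMΣ-upTo] at every genuine Θ-volume datum of every admissible `(P, l)` SOME bound
  `B(P,l,T)` with `T.negAbsLogQ − B ≤ T.negLogTheta` (what an `S_H|Σ` volume computation delivers: abc-iut-rh-typ-12 p467532 /
  rh2-q2-eq p468453 / this seat p469145 §1, `B = D_off(Σ)` resp. `offRemainder`; ASSUMPTION LABEL), [TOL-mult]
  `OffSigmaTolerance (1/(2l)) (((l+1)/4)·5·d*·l) T B` (`B ≤ T.gap/(2l) + Tol`), [CONE] `hreg` VERBATIM ⟹ `Cor22.Thm110Legendre` (print's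
  constants) ⟹ the crux `ThetaPartII` (stmt of the IUTThetaPilot route; `Cor22.exists_partII_of_thm110Legendre`, `Cor22.fullGaloisImage_holds`)
  ⟹ `ABC` (route deciding theorem `closes`; supports `genEllTwo_holds`, `JInvWlog_proof` PROVED).
RELATION (honest): for `ABC` the WINDOWED certificate of abc-iut-rh2-q2-cond (p472503 `Cor22.partII_of_displayWindow`, p473109
`Cor312Slack.ABC_of_cor312Slack_rho_of_hullRegime`: inside `2^140 < log(q^∀)`, `√(log(q^∀)) ≤ l` any relative remainder `≤ (30·d*/l)·T.gap` is free)
has WEAKER hypotheses and so SUPERSEDES this one; the present certificate is the window-free form — it goes through `Cor22.Thm110Legendre`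
itself, i.e. Thm. 1.10's display at EVERY admissible `(P, l)`, which the multiplicative share `1/(2l)` leaves intact. The new content over
p469667 is exactly that share, `T.gap/(2l) = ((l+1)/(48l) − 1/(4l²))·log(q)`, which grows with the height (not an `O(d_mod·l²)` budget).
HONEST SCOPE: CONDITIONAL; nothing is asserted about the hypotheses; nothing here asserts that abc is proved or refuted, or that Cor. 3.12
(weakened or not) holds at any datum; no side taken; typed ≠ proved; instantiated ≠ endorsed.
[cite: Mochizuki2012, IUTchIV Thm. 1.10 pp. 22–31; Cor. 2.2 (ii) pp. 41–48, Cor. 2.3 pp. 48–55] [cite: Mochizuki2012, IUTchIII Cor. 3.12 p. 173–174]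
[claim: Mochizuki2012, status: disputed]
Axioms: standard.
-/

noncomputable section

namespace Summit.ABC.IUTFork.Repair.RH.OffSigma

open Literature.IUT.LogVolume Literature.IUT.HodgeTheaters Literature.NumberTheory.DiophantineGeometry.GenEll
open Summit.ABC.ABC.Theorems Summit.ABC.IUTFork.Conditional NumberField IsDedekindDomain

/-! ## §1 The dilated squeeze at the datum from «Cor. 3.12 up to `B`» and `OffSigmaTolerance κ A T B` -/

section Datum

variable {P : NFPoint} {l : ℕ}

/-- **THE DILATED SQUEEZE AT THE DATUM** (no `κ < 1` needed): «Cor. 3.12 up to `B`» at `T`, the tolerance `B ≤ κ·T.gap + A` and the hull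
estimate with `δ` give `(1 − κ)·T.gap ≤ δ + A + ((l+5)/4)·log π` — `gap_le_of_tolerance` (p469145) before the division. Pure arithmetic;
no side taken. [cite: Mochizuki2012, IUTchIV Thm. 1.10 Steps (viii)–(x) p. 30–32] -/
theorem gap_mul_le_of_tolerance (T : Cor22.ThetaVolumeDatumAt P l) {κ A B δ : ℝ} (htol : OffSigmaTolerance κ A T B)
    (h1 : T.negAbsLogQ - B ≤ T.negLogTheta) (h2 : T.HullEstimateOf δ) :
    (1 - κ) * T.gap ≤ δ + A + ThetaVolumeInput.archLogTheta l := by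
  have h := gap_le_of_cor312UpTo T h1 h2
  unfold OffSigmaTolerance at htol
  have e : (1 - κ) * T.gap = T.gap - κ * T.gap := by ring
  rw [e]
  linarith

/-- **On the `λ`-line**: `(1 − κ)·((l+1)/24 − 1/(2l))·log(q^{∤{2,l}}(λ)) ≤ δ + A + ((l+5)/4)·log π` (abc-iut-S-d2's `PointDict.gap_eq`) —
the hypothesis `hineq` of `display_of_squeezeIII_mult` with `δ = B_III(P,l)`, `A = E`. [cite: Mochizuki2012, IUTchIV Thm. 1.10 Step (viii) p. 30] -/
theorem logQAvoid_mul_le_of_tolerance (T : Cor22.ThetaVolumeDatumAt P l) (hU : P.InU) {κ A B δ : ℝ}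
    (htol : OffSigmaTolerance κ A T B) (h1 : T.negAbsLogQ - B ≤ T.negLogTheta) (h2 : T.HullEstimateOf δ) :
    (1 - κ) * ((((l : ℝ) + 1) / 24 - 1 / (2 * l)) * Cor22.logQAvoid P {2, l}) ≤
      δ + A + ThetaVolumeInput.archLogTheta l := by
  rw [← PointDict.gap_eq T hU]
  exact gap_mul_le_of_tolerance T htol h1 h2

/-- On the `λ`-line the datum's gap is nonnegative (`T.gap = ((l+1)/24 − 1/(2l))·log(q^{∤{2,l}})`, `l ≥ 4`, `log(q^{∤{2,l}}) ≥ 0`).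
[cite: Mochizuki2012, IUTchIV Thm. 1.10 Step (viii) p. 30] -/
theorem gap_nonneg (T : Cor22.ThetaVolumeDatumAt P l) (hU : P.InU) (h4 : 4 ≤ l) : 0 ≤ T.gap := by
  rw [PointDict.gap_eq T hU]
  have hl4 : (4 : ℝ) ≤ l := by exact_mod_cast h4
  have hl0 : (0 : ℝ) < l := by linarith
  have hc : 0 ≤ ((l : ℝ) + 1) / 24 - 1 / (2 * l) := by
    rw [div_sub_div _ _ (by norm_num) (by positivity), le_div_iff₀ (by positivity), zero_mul]
    nlinarith
  exact mul_nonneg hc (Cor22.logQAvoid_nonneg P {2, l})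

/-- **The tolerance is MONOTONE in `κ`** where the gap is nonnegative: `B ≤ κ·T.gap + A` and `κ ≤ κ'` give `B ≤ κ'·T.gap + A`. So a datum
with `ρ = E_off⁺/gap ≤ κ ≤ 1/(2l)` (beyond its additive share) satisfies the hypothesis of §4. [folklore] -/
theorem offSigmaTolerance_of_le_kappa (T : Cor22.ThetaVolumeDatumAt P l) {κ κ' A B : ℝ} (hgap : 0 ≤ T.gap) (hκ : κ ≤ κ')
    (h : OffSigmaTolerance κ A T B) : OffSigmaTolerance κ' A T B := by
  unfold OffSigmaTolerance at h ⊢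
  nlinarith [mul_le_mul_of_nonneg_right hκ hgap]

/-- **CONTENT OF THE MULTIPLICATIVE SHARE**: on the `λ`-line `T.gap/(2l) = (((l+1)/(48·l)) − 1/(4l²))·log(q^{∤{2,l}}(λ))` — it grows with the
height, so it is NOT an `O(d_mod·l²)` budget (the additive doors p469667 / p470106 do not cover it). [cite: Mochizuki2012, IUTchIV Thm. 1.10 Step (viii) p. 30] -/
theorem gap_div_two_l_eq (T : Cor22.ThetaVolumeDatumAt P l) (hU : P.InU) (hl0 : 0 < l) :
    1 / (2 * (l : ℝ)) * T.gap = (((l : ℝ) + 1) / (48 * l) - 1 / (4 * (l : ℝ) ^ 2)) * Cor22.logQAvoid P {2, l} := by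
  rw [PointDict.gap_eq T hU]
  have hl : (0 : ℝ) < l := by exact_mod_cast hl0
  field_simp
  ring

end Datum

/-! ## §2 `Thm110Legendre`, the crux `ThetaPartII` and `ABC` from «Cor. 3.12 up to `B`» under the multiplicative tolerance and the cone binder -/

/-- **`Cor22.Thm110Legendre` (print's constants) from «Cor. 3.12 up to `B`» under `OffSigmaTolerance (1/(2l)) Tol` and the cone binder `hreg`**
(the multiplicative twin of abc-iut-rh2-q2-cond's `Cor312Slack.thm110Legendre_of_cor312Slack_of_hullRegime`): at each admissible `(P, l)` a
genuine datum exists (abc-iut-L5-t7 `ThetaPartII.stub_thetaData`), the hull estimate with `B_III` holds at it (`ThetaPartII.hullVolume_of_hullRegime`),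
§3 gives the dilated squeeze and §2 the display; `l ≠ 5` by `ThetaPartIIDisplay.thm110Legendre_of_pointwise`. CONDITIONAL on `h312B`, `hTol`,
`hreg`; no side taken. [cite: Mochizuki2012, IUTchIV Thm. 1.10 pp. 22–31; Cor. 2.2 (ii) proof p. 46] [claim: Mochizuki2012, status: disputed] -/
theorem thm110Legendre_of_offSigmaToleranceMult_of_hullRegime
    (B : ∀ (P : NFPoint) (l : ℕ), Cor22.ThetaVolumeDatumAt P l → ℝ)
    (h312B : ∀ P : NFPoint, P ∈ UP → ∀ l : ℕ, l.Prime → 5 ≤ l →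
      Cor22.AdmitsCore P → Cor22.CondP2 P l → Cor22.CondP5 P l → Cor22.CondP6 P l →
      ∀ T : Cor22.ThetaVolumeDatumAt P l, T.negAbsLogQ - B P l T ≤ T.negLogTheta)
    (hTol : ∀ P : NFPoint, P ∈ UP → ∀ l : ℕ, l.Prime → 5 ≤ l →
      Cor22.AdmitsCore P → Cor22.CondP2 P l → Cor22.CondP5 P l → Cor22.CondP6 P l →
      ∀ T : Cor22.ThetaVolumeDatumAt P l,
        OffSigmaTolerance (1 / (2 * (l : ℝ))) (((l : ℝ) + 1) / 4 * (5 * ((((2 ^ 12 * 3 ^ 3 * 5 * Cor22.dmod P : ℕ) : ℝ)) * l)))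
          T (B P l T))
    (hreg : ∀ P : NFPoint, P ∈ UP → ∀ l : ℕ, l.Prime → 5 ≤ l →
      Cor22.AdmitsCore P → Cor22.CondP2 P l → Cor22.CondP5 P l → Cor22.CondP6 P l →
      ∀ T : Cor22.ThetaVolumeDatumAt P l,
        (letI := T.instFieldF; letI := T.instNumberFieldF; letI := T.instAlgebraF; letI := T.instFieldK
         letI := T.instNumberFieldK; letI := T.instAlgebraK; letI := T.instFieldFbar; letI := T.instAlgebraFbar
         letI := T.instAlgebraKFbar; letI := T.instIsElliptic
         ¬ (∀ p ∈ T.I.supportPrimes, ∀ v w : placesOver (fieldOfModuli T.E) p,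
            (Summit.ABC.IUTFork.DHData.ofInput T.I).logQloc p v = (Summit.ABC.IUTFork.DHData.ofInput T.I).logQloc p w)) →
        T.HullEstimateOf
          (((l : ℝ) + 1) / 4 *
            ((1 + 12 * (Cor22.dmod P : ℝ) / l) * (P.logDiff + Cor22.logCondAvoid P {2, l})
              + 2 * Real.log l + 52
              + 20 / 3 * Real.log (((2 ^ 12 * 3 ^ 3 * 5 * Cor22.dmod P : ℕ) : ℝ) * (l : ℝ))
                * (Nat.primeCounting (2 ^ 12 * 3 ^ 3 * 5 * Cor22.dmod P * l) : ℝ)))) :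
    Cor22.Thm110Legendre :=
  ThetaPartIIDisplay.thm110Legendre_of_pointwise fun η hη P hP l hl h5 hne hcore hP2 hP5 h6 => by
    obtain ⟨T⟩ := ThetaPartII.stub_thetaData P hP l hl h5 hcore hP2 hP5 h6
    have hU : P.InU := hP.1
    have hl0 : (0 : ℝ) < l := by exact_mod_cast lt_of_lt_of_le (by norm_num) h5
    have hsq := logQAvoid_mul_le_of_tolerance T hU (hTol P hP l hl h5 hcore hP2 hP5 h6 T) (h312B P hP l hl h5 hcore hP2 hP5 h6 T)
      (ThetaPartII.hullVolume_of_hullRegime hreg P hP l hl h5 hcore hP2 hP5 h6 T)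
    exact display_of_squeezeIII_mult' hl h5 hne hη le_rfl le_rfl hsq

/-- **The crux `ThetaPartII` from «Cor. 3.12 up to `B`» under the multiplicative tolerance and the cone binder** (abc-iut-S3's
`Cor22.exists_partII_of_thm110Legendre` + the proved `Cor22.fullGaloisImage_holds`). CONDITIONAL; does not close any item; no side taken.
[cite: Mochizuki2012, IUTchIV Cor. 2.2 (ii) pp. 41–48] [claim: Mochizuki2012, status: disputed] -/
theorem ThetaPartII_of_offSigmaToleranceMult_of_hullRegime
    (B : ∀ (P : NFPoint) (l : ℕ), Cor22.ThetaVolumeDatumAt P l → ℝ)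
    (h312B : ∀ P : NFPoint, P ∈ UP → ∀ l : ℕ, l.Prime → 5 ≤ l →
      Cor22.AdmitsCore P → Cor22.CondP2 P l → Cor22.CondP5 P l → Cor22.CondP6 P l →
      ∀ T : Cor22.ThetaVolumeDatumAt P l, T.negAbsLogQ - B P l T ≤ T.negLogTheta)
    (hTol : ∀ P : NFPoint, P ∈ UP → ∀ l : ℕ, l.Prime → 5 ≤ l →
      Cor22.AdmitsCore P → Cor22.CondP2 P l → Cor22.CondP5 P l → Cor22.CondP6 P l →
      ∀ T : Cor22.ThetaVolumeDatumAt P l,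
        OffSigmaTolerance (1 / (2 * (l : ℝ))) (((l : ℝ) + 1) / 4 * (5 * ((((2 ^ 12 * 3 ^ 3 * 5 * Cor22.dmod P : ℕ) : ℝ)) * l)))
          T (B P l T))
    (hreg : ∀ P : NFPoint, P ∈ UP → ∀ l : ℕ, l.Prime → 5 ≤ l →
      Cor22.AdmitsCore P → Cor22.CondP2 P l → Cor22.CondP5 P l → Cor22.CondP6 P l →
      ∀ T : Cor22.ThetaVolumeDatumAt P l,
        (letI := T.instFieldF; letI := T.instNumberFieldF; letI := T.instAlgebraF; letI := T.instFieldK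
         letI := T.instNumberFieldK; letI := T.instAlgebraK; letI := T.instFieldFbar; letI := T.instAlgebraFbar
         letI := T.instAlgebraKFbar; letI := T.instIsElliptic
         ¬ (∀ p ∈ T.I.supportPrimes, ∀ v w : placesOver (fieldOfModuli T.E) p,
            (Summit.ABC.IUTFork.DHData.ofInput T.I).logQloc p v = (Summit.ABC.IUTFork.DHData.ofInput T.I).logQloc p w)) →
        T.HullEstimateOf
          (((l : ℝ) + 1) / 4 *
            ((1 + 12 * (Cor22.dmod P : ℝ) / l) * (P.logDiff + Cor22.logCondAvoid P {2, l})
              + 2 * Real.log l + 52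
              + 20 / 3 * Real.log (((2 ^ 12 * 3 ^ 3 * 5 * Cor22.dmod P : ℕ) : ℝ) * (l : ℝ))
                * (Nat.primeCounting (2 ^ 12 * 3 ^ 3 * 5 * Cor22.dmod P * l) : ℝ)))) :
    Summit.ABC.ABC.Theses.IUTThetaPilot.ThetaPartII := by
  unfold Summit.ABC.ABC.Theses.IUTThetaPilot.ThetaPartII
  exact Cor22.exists_partII_of_thm110Legendre (thm110Legendre_of_offSigmaToleranceMult_of_hullRegime B h312B hTol hreg)
    Cor22.fullGaloisImage_holds

/-- **`abc` FROM «COR. 3.12 UP TO `B`» UNDER THE MULTIPLICATIVE TOLERANCE AND THE CONE BINDER** — [NUMΣ-upTo] at every genuine Θ-volume datum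
of every admissible `(P, l)` a bound `B(P,l,T)` with `T.negAbsLogQ − B ≤ T.negLogTheta` (what an `S_H|Σ` volume computation delivers, `B` =
the off-Σ deficit; ASSUMPTION LABEL), [TOL-mult] `B ≤ T.gap/(2l) + ((l+1)/4)·5·d*_mod·l` (`OffSigmaTolerance (1/(2l)) Tol T B`), [CONE] `hreg`
verbatim ⟹ `ABC`, with NO constant of the chain of record changed (route deciding theorem `closes`; supports `genEllTwo_holds`, `JInvWlog_proof`
PROVED). At `κ = 0` this is abc-iut-rh2-q2-cond's `Cor312Slack.ABC_of_cor312Slack_of_hullRegime`. CONDITIONAL; nothing is asserted about the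
hypotheses; no side taken. [cite: Mochizuki2012, IUTchIV Cor. 2.2–2.3 pp. 41–55] [cite: Mochizuki2012, IUTchIII Cor. 3.12 p. 174]
[claim: Mochizuki2012, status: disputed] -/
theorem ABC_of_offSigmaToleranceMult_of_hullRegime
    (B : ∀ (P : NFPoint) (l : ℕ), Cor22.ThetaVolumeDatumAt P l → ℝ)
    (h312B : ∀ P : NFPoint, P ∈ UP → ∀ l : ℕ, l.Prime → 5 ≤ l →
      Cor22.AdmitsCore P → Cor22.CondP2 P l → Cor22.CondP5 P l → Cor22.CondP6 P l →
      ∀ T : Cor22.ThetaVolumeDatumAt P l, T.negAbsLogQ - B P l T ≤ T.negLogTheta)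
    (hTol : ∀ P : NFPoint, P ∈ UP → ∀ l : ℕ, l.Prime → 5 ≤ l →
      Cor22.AdmitsCore P → Cor22.CondP2 P l → Cor22.CondP5 P l → Cor22.CondP6 P l →
      ∀ T : Cor22.ThetaVolumeDatumAt P l,
        OffSigmaTolerance (1 / (2 * (l : ℝ))) (((l : ℝ) + 1) / 4 * (5 * ((((2 ^ 12 * 3 ^ 3 * 5 * Cor22.dmod P : ℕ) : ℝ)) * l)))
          T (B P l T))
    (hreg : ∀ P : NFPoint, P ∈ UP → ∀ l : ℕ, l.Prime → 5 ≤ l →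
      Cor22.AdmitsCore P → Cor22.CondP2 P l → Cor22.CondP5 P l → Cor22.CondP6 P l →
      ∀ T : Cor22.ThetaVolumeDatumAt P l,
        (letI := T.instFieldF; letI := T.instNumberFieldF; letI := T.instAlgebraF; letI := T.instFieldK
         letI := T.instNumberFieldK; letI := T.instAlgebraK; letI := T.instFieldFbar; letI := T.instAlgebraFbar
         letI := T.instAlgebraKFbar; letI := T.instIsElliptic
         ¬ (∀ p ∈ T.I.supportPrimes, ∀ v w : placesOver (fieldOfModuli T.E) p,
            (Summit.ABC.IUTFork.DHData.ofInput T.I).logQloc p v = (Summit.ABC.IUTFork.DHData.ofInput T.I).logQloc p w)) →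
        T.HullEstimateOf
          (((l : ℝ) + 1) / 4 *
            ((1 + 12 * (Cor22.dmod P : ℝ) / l) * (P.logDiff + Cor22.logCondAvoid P {2, l})
              + 2 * Real.log l + 52
              + 20 / 3 * Real.log (((2 ^ 12 * 3 ^ 3 * 5 * Cor22.dmod P : ℕ) : ℝ) * (l : ℝ))
                * (Nat.primeCounting (2 ^ 12 * 3 ^ 3 * 5 * Cor22.dmod P * l) : ℝ)))) :
    _root_.ABC :=
  Summit.ABC.ABC.Theses.IUTThetaPilot.closes (ThetaPartII_of_offSigmaToleranceMult_of_hullRegime B h312B hTol hreg)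
    Summit.ABC.ABC.Theorems.genEllTwo_holds Summit.ABC.ABC.Theorems.JInvWlog_proof

end Summit.ABC.IUTFork.Repair.RH.OffSigma

end
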